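import Literature.NumberTheory.ComplexMultiplication.CMTypeRank
import Literature.NumberTheory.ComplexMultiplication.SexticCMTypesB3Abstract
import HarnessLib

/-!
# Two pair-flip slots with the same type stabiliser, I: the pointwise stabilisers and the pair-preserving
# subgroups of the two slots coincide

Companion of `NumberTheory/ComplexMultiplication/CMTypeRankIrreducibleSlot` (pair flips make `U(Φ)` irreducible)
and `CMTypeRankTypeConjugation` §2 (STABILISER SEPARATION: for a two-slot family, an element stabilising the type
`Φ₀` but not `Φ₁` gives rank additivity when `U(Φ₁)` is irreducible).  For two pair-flip slots stabiliser
separation therefore settles `Hg(A₀ × A₁) = Hg(A₀) × Hg(A₁)` UNLESS the two types have the SAME stabiliser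
`Stab(Φ) = Stab(Ψ) ≤ G`.  This file and its sequel `CMTypeRankPairFlipStabilizers` show that equal stabilisers force
the two typed slots to be ISOMORPHIC (so that, for CM fields, the abelian varieties are isogenous): here the first
half, the transfer of the POINTWISE STABILISER and of the PAIR-PRESERVING subgroup from one slot to the other.

SETTING (abstract; `G` any group).  `G` acts on `X` and on `Y`; `ρ ∈ G` acts on both as a commuting
fixed-point-free involution; `Φ ⊆ X`, `Ψ ⊆ Y` are CM types for `ρ` (`IsCMTypeWith`); a slot HAS PAIR FLIPS if every
pair `{x, ρx}` is exchanged by some `φ ∈ G` fixing the other points OF THAT SLOT (nothing is asked of `φ` on the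
other slot).  "`g` stabilises `Φ`" is `∀ x, g • x ∈ Φ ↔ x ∈ Φ`; "`a` preserves the pairs of `X`" is
`∀ x, a • x = x ∨ a • x = ρ • x`.

* §1 One slot.  `IsCMTypeWith.preimage_smul` (translates of types are types); `exists_smul_mem_and_smul_not_mem`
  (pair flips SEPARATE: for `x' ≠ x` some translate of `Φ` contains `x` but not `x'`);
  `exists_pairPreserving_translate` (pair flips are TRANSITIVE ON TYPES through pair-preserving elements: every
  `ρ`-type is `a⁻¹Φ` with `a` pair-preserving); `not_forall_stabilizes_of_pairPreserving` (a pair-preserving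
  element moving a point stabilises no type); and the six-point lemma `pairPreserving_of_forall_not_stabilizes`:
  on a SIX-point slot an element `ι` with `ι²` trivial such that neither `ι` nor `ιρ` stabilises any `ρ`-type
  preserves every pair (normal form `SexticB3.exists_equiv_cc` + a `decide` over the `6³` sign-compatible maps).
* §2 Two slots with `Stab(Φ) = Stab(Ψ)`.  **`forall_smul_eq_of_forall_smul_eq`** — an element acting trivially
  on `Y` acts trivially on `X` (its conjugates stabilise `Ψ`, hence `Φ`, hence every translate of `Φ`, and the
  translates separate points); **`smul_eq_smul_of_forall_smul_eq`** (elements agreeing on `X` agree on `Y`);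
  **`pairPreserving_of_pairPreserving`** — an element preserving the pairs of `X` preserves the pairs of `Y`
  (`|Y| = 6`): it and its product with `ρ` stabilise no translate of `Φ`, hence no translate of `Ψ`, hence no
  `ρ`-type of `Y` at all, and its square is trivial on `Y`.

All statements are one-directional with the two slots explicit, to be used in both directions.  Theorems only:
no definition, no named fact, no `sorry`.

## References

* [Gordon1999HodgeAVSurvey] B. B. Gordon, *A survey of the Hodge conjecture for abelian varieties*, §3 Theorem
  (proof), 7.4–7.7.
* [Dodson1984] B. Dodson, *The structure of Galois groups of CM-fields*, Trans. AMS 283 (1984), §1.1 (imprimitivity: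
  `Gal ≤ (ℤ/2)ⁿ ⋊ 𝔖ₙ`), §5.1.2 (sign changes).
* [Shimura1998] G. Shimura, *Abelian Varieties with Complex Multiplication and Modular Functions*, §8.2 Prop. 26.
-/

set_option autoImplicit false

namespace Literature.NumberTheory.ComplexMultiplication

variable {G : Type*} [Group G]

/-! ### §1 One pair-flip slot -/

section OneSlot

variable {X : Type*} [MulAction G X] {ρ : G} {Φ : Set X}

/-- **A translate `g⁻¹Φ = {x | gx ∈ Φ}` of a CM type is a CM type.** [cite: Shimura1998, §8.2 (p. 61)] -/
theorem IsCMTypeWith.preimage_smul (h : IsCMTypeWith ρ Φ) (g : G) : IsCMTypeWith ρ {x : X | g • x ∈ Φ} where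
  mem_iff x := by
    simp only [Set.mem_setOf_eq]
    rw [h.comm, h.mem_iff (g • x)]
  comm := h.comm
  invol := h.invol

/-- **Pair flips separate points by translates**: for `x' ≠ x` some `g ∈ G` has `gx ∈ Φ`, `gx' ∉ Φ` (the
translate `g⁻¹Φ` contains `x` and not `x'`). [cite: Shimura1998, §8.2 Prop. 26] -/
theorem exists_smul_mem_and_smul_not_mem (h : IsCMTypeWith ρ Φ)
    (hflip : ∀ x : X, ∃ φ : G, φ • x = ρ • x ∧ ∀ y : X, y ≠ x → y ≠ ρ • x → φ • y = y)
    (x x' : X) (hx : x' ≠ x) : ∃ g : G, g • x ∈ Φ ∧ g • x' ∉ Φ := by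
  classical
  by_cases hxΦ : x ∈ Φ
  · by_cases hx'Φ : x' ∈ Φ
    · -- flip `x'` out
      obtain ⟨φ, hφx', hφ⟩ := hflip x'
      have hxρ : x ≠ ρ • x' := fun hc => (h.mem_iff x').1 hx'Φ (hc ▸ hxΦ)
      refine ⟨φ, ?_, ?_⟩
      · rw [hφ x hx.symm hxρ]; exact hxΦ
      · rw [hφx']; exact (h.mem_iff x').1 hx'Φ
    · exact ⟨1, by rw [one_smul]; exact hxΦ, by rw [one_smul]; exact hx'Φ⟩
  · have hρx : ρ • x ∈ Φ := by
      by_contra hc; exact hxΦ ((h.mem_iff x).2 hc)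
    by_cases hx'ρ : x' = ρ • x
    · refine ⟨ρ, hρx, ?_⟩
      rw [hx'ρ, h.invol]; exact hxΦ
    · by_cases hρx' : ρ • x' ∈ Φ
      · -- flip at `ρ x'`, then apply `ρ`
        obtain ⟨φ, hφ1, hφ⟩ := hflip (ρ • x')
        have hx'Φ : x' ∉ Φ := fun hc => (h.mem_iff x').1 hc hρx'
        have hne1 : ρ • x ≠ ρ • x' := fun hc => hx (by simpa [h.invol] using (congrArg (ρ • ·) hc).symm)
        have hne2 : ρ • x ≠ ρ • ρ • x' := by rw [h.invol]; exact fun hc => hx'ρ hc.symm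
        refine ⟨φ * ρ, ?_, ?_⟩
        · rw [mul_smul, hφ (ρ • x) hne1 hne2]; exact hρx
        · rw [mul_smul, hφ1, h.invol]; exact hx'Φ
      · exact ⟨ρ, hρx, hρx'⟩

/-- `ρ` preserves the pairs. [folklore] -/
private theorem pairPreserving_rho (x : X) : ρ • x = x ∨ ρ • x = ρ • x := Or.inr rfl

/-- A pair flip preserves the pairs. [cite: Dodson1984, §1.1] -/
theorem pairPreserving_of_flip (h : IsCMTypeWith ρ Φ) {x : X} {φ : G} (hφx : φ • x = ρ • x)
    (hφ : ∀ y : X, y ≠ x → y ≠ ρ • x → φ • y = y) (y : X) : φ • y = y ∨ φ • y = ρ • y := by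
  by_cases hyx : y = x
  · exact Or.inr (hyx ▸ hφx)
  · by_cases hyρ : y = ρ • x
    · right; rw [hyρ, h.comm, hφx]
    · exact Or.inl (hφ y hyx hyρ)

/-- Products of pair-preserving elements preserve the pairs. [cite: Dodson1984, §1.1] -/
theorem pairPreserving_mul (h : IsCMTypeWith ρ Φ) {a b : G} (ha : ∀ x : X, a • x = x ∨ a • x = ρ • x)
    (hb : ∀ x : X, b • x = x ∨ b • x = ρ • x) (x : X) : (a * b) • x = x ∨ (a * b) • x = ρ • x := by
  rw [mul_smul]
  rcases hb x with hbx | hbx <;> rw [hbx]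
  · exact ha x
  · rcases ha (ρ • x) with hax | hax
    · exact Or.inr hax
    · left; rw [hax, h.invol]

/-- Inverses of pair-preserving elements preserve the pairs. [cite: Dodson1984, §1.1] -/
theorem pairPreserving_inv (h : IsCMTypeWith ρ Φ) {a : G} (ha : ∀ x : X, a • x = x ∨ a • x = ρ • x) (x : X) :
    a⁻¹ • x = x ∨ a⁻¹ • x = ρ • x := by
  rcases ha (a⁻¹ • x) with hax | hax
  · rw [smul_inv_smul] at hax; exact Or.inl hax.symm
  · rw [smul_inv_smul] at hax
    right
    have := congrArg (ρ • ·) hax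
    simp only [h.invol] at this
    exact this.symm

/-- The square of a pair-preserving element acts trivially. [cite: Dodson1984, §1.1] -/
theorem smul_smul_eq_of_pairPreserving (h : IsCMTypeWith ρ Φ) {a : G} (ha : ∀ x : X, a • x = x ∨ a • x = ρ • x)
    (x : X) : a • a • x = x := by
  rcases ha x with hax | hax
  · rw [hax, hax]
  · rw [hax, h.comm, hax, h.invol]

/-- **A pair-preserving element moving some point stabilises NO `ρ`-type** (it flips that point's pair, and a type
contains exactly one of the two). [cite: Dodson1984, §1.1] -/
theorem not_forall_stabilizes_of_pairPreserving {a : G} {x₀ : X} (hx₀ : a • x₀ = ρ • x₀) {T : Set X}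
    (hT : IsCMTypeWith ρ T) : ∃ x : X, ¬(a • x ∈ T ↔ x ∈ T) := by
  refine ⟨x₀, fun hc => ?_⟩
  rw [hx₀] at hc
  by_cases hm : x₀ ∈ T
  · exact (hT.mem_iff x₀).1 hm (hc.2 hm)
  · exact hm (hc.1 (by by_contra hc'; exact hm ((hT.mem_iff x₀).2 hc')))

variable [Fintype X] [DecidableEq X]

/-- **Pair flips are transitive on types through pair-preserving elements**: every `ρ`-type `T ⊆ X` is the translate
`{x | a • x ∈ Φ}` of `Φ` by an element `a` preserving the pairs (a product of the flips at the pairs where `T` and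
`Φ` differ; induction on their number). [cite: Dodson1984, §5.1.2] -/
theorem exists_pairPreserving_translate (h : IsCMTypeWith ρ Φ)
    (hflip : ∀ x : X, ∃ φ : G, φ • x = ρ • x ∧ ∀ y : X, y ≠ x → y ≠ ρ • x → φ • y = y)
    {T : Set X} (hT : IsCMTypeWith ρ T) :
    ∃ a : G, (∀ x : X, a • x = x ∨ a • x = ρ • x) ∧ ∀ x : X, a • x ∈ Φ ↔ x ∈ T := by
  classical
  suffices key : ∀ (n : ℕ) (T : Set X), IsCMTypeWith ρ T →
      (Finset.univ.filter fun x : X => x ∈ T ∧ x ∉ Φ).card = n →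
      ∃ a : G, (∀ x : X, a • x = x ∨ a • x = ρ • x) ∧ ∀ x : X, a • x ∈ Φ ↔ x ∈ T from key _ T hT rfl
  intro n
  induction n using Nat.strong_induction_on with
  | _ n ih =>
    intro T hT hn
    by_cases h0 : ∃ x, x ∈ T ∧ x ∉ Φ
    · obtain ⟨x₁, hx₁T, hx₁Φ⟩ := h0
      obtain ⟨φ, hφx, hφ⟩ := hflip x₁
      have hT' : IsCMTypeWith ρ {x : X | φ • x ∈ T} := hT.preimage_smul φ
      have hρx₁T : ρ • x₁ ∉ T := (hT.mem_iff x₁).1 hx₁T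
      have hρx₁Φ : ρ • x₁ ∈ Φ := by by_contra hc; exact hx₁Φ ((h.mem_iff x₁).2 hc)
      have hsub : (Finset.univ.filter fun x : X => x ∈ {x : X | φ • x ∈ T} ∧ x ∉ Φ) ⊂
          Finset.univ.filter fun x : X => x ∈ T ∧ x ∉ Φ := by
        rw [Finset.ssubset_iff_of_subset]
        · refine ⟨x₁, by simp [hx₁T, hx₁Φ], ?_⟩
          simp [Set.mem_setOf_eq, hφx, hρx₁T]
        · intro x hx
          simp only [Finset.mem_filter, Finset.mem_univ, true_and, Set.mem_setOf_eq] at hx ⊢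
          refine ⟨?_, hx.2⟩
          by_cases h1 : x = x₁
          · subst h1; rw [hφx] at hx; exact absurd hx.1 hρx₁T
          · by_cases h2 : x = ρ • x₁
            · subst h2; exact absurd hρx₁Φ hx.2
            · rw [hφ x h1 h2] at hx; exact hx.1
      obtain ⟨a', ha'p, ha'⟩ := ih _ (hn ▸ Finset.card_lt_card hsub) _ hT' rfl
      refine ⟨a' * φ⁻¹, pairPreserving_mul h ha'p (pairPreserving_inv h (pairPreserving_of_flip h hφx hφ)),
        fun x => ?_⟩
      rw [mul_smul, ha' (φ⁻¹ • x), Set.mem_setOf_eq, smul_inv_smul]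
    · push Not at h0
      refine ⟨1, fun x => Or.inl (one_smul _ _), fun x => ?_⟩
      rw [one_smul]
      refine ⟨fun hx => ?_, fun hx => h0 x hx⟩
      by_contra hxT
      have hρxT : ρ • x ∈ T := by by_contra hc; exact hxT ((hT.mem_iff x).2 hc)
      exact (h.mem_iff x).1 hx (h0 (ρ • x) hρxT)

/-- The finite core of `pairPreserving_of_forall_not_stabilizes`: on `Fin 6` with conjugation `i ↦ i + 3`, a
sign-compatible involution `p` moving the pair of `0` admits a CM type stable under `p` or under `p ∘ (+3)`.
[cite: Dodson1984, §5.1.2] -/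
private theorem fin6_core : ∀ a b c : Fin 6,
    (∀ i : Fin 6, (![a, b, c, a + 3, b + 3, c + 3] : Fin 6 → Fin 6)
      ((![a, b, c, a + 3, b + 3, c + 3] : Fin 6 → Fin 6) i) = i) → a ≠ 0 → a ≠ 3 →
      ∃ T ∈ ([{0, 1, 2}, {0, 1, 5}, {0, 4, 2}, {0, 4, 5}] : List (Finset (Fin 6))),
        (∀ i : Fin 6, i ∈ T ↔ i + 3 ∉ T) ∧
        ((∀ i : Fin 6, (![a, b, c, a + 3, b + 3, c + 3] : Fin 6 → Fin 6) i ∈ T ↔ i ∈ T) ∨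
          (∀ i : Fin 6, (![a, b, c, a + 3, b + 3, c + 3] : Fin 6 → Fin 6) (i + 3) ∈ T ↔ i ∈ T)) := by
  decide

/-- **Six points: an element stabilising no type, together with its `ρ`-twin, preserves the pairs.**  Let `|X| = 6`,
`ι ∈ G` with `ι²` acting trivially on `X`, and suppose that NO `ρ`-type of `X` is stabilised by `ι` and none by
`ιρ`.  Then `ι` preserves every pair `{x, ρx}` (if `ι` moved a pair it would swap two pairs and fix the third
setwise; acting on the third pair trivially it stabilises a type, acting as `ρ` there `ιρ` does).
[cite: Dodson1984, §5.1.2] -/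
theorem pairPreserving_of_forall_not_stabilizes (h : IsCMTypeWith ρ Φ) (hcard : Fintype.card X = 6) {ι : G}
    (hι2 : ∀ x : X, ι • ι • x = x) (hι : ∀ T : Set X, IsCMTypeWith ρ T → ∃ x, ¬(ι • x ∈ T ↔ x ∈ T))
    (hιρ : ∀ T : Set X, IsCMTypeWith ρ T → ∃ x, ¬((ι * ρ) • x ∈ T ↔ x ∈ T)) (x₀ : X) :
    ι • x₀ = x₀ ∨ ι • x₀ = ρ • x₀ := by
  by_contra hnot
  push Not at hnot
  obtain ⟨e, he0, heρ⟩ := SexticB3.exists_equiv_cc hcard (MulAction.toPerm ρ)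
    (fun x => by simp [MulAction.toPerm_apply, h.invol]) (fun x => h.rho_smul_ne x) x₀
  replace heρ : ∀ x : X, e (ρ • x) = e x + 3 := fun x => by
    simpa [MulAction.toPerm_apply, SexticB3.cc_apply] using heρ x
  have hsymm : ∀ i : Fin 6, e.symm (i + 3) = ρ • e.symm i := fun i =>
    e.injective (by rw [heρ, Equiv.apply_symm_apply, Equiv.apply_symm_apply])
  set p : Fin 6 → Fin 6 := fun i => e (ι • e.symm i) with hp_def
  have hp3 : ∀ i, p (i + 3) = p i + 3 := fun i => by
    simp only [hp_def, hsymm, h.comm, heρ]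
  have hpp : ∀ i, p (p i) = i := fun i => by
    simp only [hp_def, Equiv.symm_apply_apply, hι2, Equiv.apply_symm_apply]
  have hsymm0 : e.symm 0 = x₀ := e.injective (by rw [Equiv.apply_symm_apply, he0])
  have hp00 : p 0 ≠ 0 := fun hc => hnot.1 (e.injective (by
    have : e (ι • x₀) = 0 := by simpa [hp_def, hsymm0] using hc
    rw [this, he0]))
  have hp03 : p 0 ≠ 3 := fun hc => hnot.2 (e.injective (by
    have : e (ι • x₀) = 3 := by simpa [hp_def, hsymm0] using hc
    rw [this, heρ, he0]; rfl))
  have hpeq : p = ![p 0, p 1, p 2, p 0 + 3, p 1 + 3, p 2 + 3] := by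
    funext i
    fin_cases i
    · rfl
    · rfl
    · rfl
    · simpa using hp3 0
    · simpa using hp3 1
    · simpa using hp3 2
  obtain ⟨T, -, hTcm, hT⟩ := fin6_core (p 0) (p 1) (p 2) (fun i => by rw [← hpeq, hpp]) hp00 hp03
  rw [← hpeq] at hT
  have hTX : IsCMTypeWith ρ {x : X | e x ∈ T} :=
    ⟨fun x => by simp only [Set.mem_setOf_eq, heρ]; exact hTcm (e x), h.comm, h.invol⟩
  rcases hT with hT | hT
  · obtain ⟨x, hx⟩ := hι _ hTX
    apply hx
    simp only [Set.mem_setOf_eq]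
    have := hT (e x)
    simp only [hp_def, Equiv.symm_apply_apply] at this
    exact this
  · obtain ⟨x, hx⟩ := hιρ _ hTX
    apply hx
    simp only [Set.mem_setOf_eq, mul_smul]
    have := hT (e x)
    simp only [hp_def, hsymm, Equiv.symm_apply_apply] at this
    exact this

end OneSlot

/-! ### §2 Two pair-flip slots with the same type stabiliser -/

section TwoSlots

variable {X Y : Type*} [MulAction G X] [MulAction G Y] {ρ : G} {Φ : Set X} {Ψ : Set Y}

/-- **Equal type stabilisers: what acts trivially on `Y` acts trivially on `X`.**  If `Stab(Φ) = Stab(Ψ)` and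
`X` has pair flips, an element `n` fixing `Y` pointwise fixes `X` pointwise: every conjugate `gng⁻¹` fixes `Y`,
stabilises `Ψ`, hence `Φ`, so `n` stabilises every translate `g⁻¹Φ`, and these separate the points of `X`.
[cite: Gordon1999HodgeAVSurvey, §3 Theorem (proof)] [cite: Shimura1998, §8.2 Prop. 26] -/
theorem forall_smul_eq_of_forall_smul_eq (hΦ : IsCMTypeWith ρ Φ)
    (hflipX : ∀ x : X, ∃ φ : G, φ • x = ρ • x ∧ ∀ y : X, y ≠ x → y ≠ ρ • x → φ • y = y)
    (hS : ∀ g : G, (∀ x : X, g • x ∈ Φ ↔ x ∈ Φ) ↔ ∀ y : Y, g • y ∈ Ψ ↔ y ∈ Ψ)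
    {n : G} (hn : ∀ y : Y, n • y = y) (x : X) : n • x = x := by
  by_contra hx
  obtain ⟨g, hgx, hgnx⟩ := exists_smul_mem_and_smul_not_mem hΦ hflipX x (n • x) hx
  have hstab : ∀ x' : X, (g * n * g⁻¹) • x' ∈ Φ ↔ x' ∈ Φ :=
    (hS _).2 fun y => by rw [mul_smul, mul_smul, hn, smul_inv_smul]
  have := (hstab (g • x)).2 hgx
  rw [mul_smul, mul_smul, inv_smul_smul] at this
  exact hgnx this

/-- **Elements agreeing on `X` agree on `Y`** (under `Stab(Φ) = Stab(Ψ)`, pair flips on `Y`).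
[cite: Gordon1999HodgeAVSurvey, §3 Theorem (proof)] -/
theorem smul_eq_smul_of_forall_smul_eq (hΨ : IsCMTypeWith ρ Ψ)
    (hflipY : ∀ y : Y, ∃ φ : G, φ • y = ρ • y ∧ ∀ z : Y, z ≠ y → z ≠ ρ • y → φ • z = z)
    (hS : ∀ g : G, (∀ x : X, g • x ∈ Φ ↔ x ∈ Φ) ↔ ∀ y : Y, g • y ∈ Ψ ↔ y ∈ Ψ)
    {g₁ g₂ : G} (h12 : ∀ x : X, g₁ • x = g₂ • x) (y : Y) : g₁ • y = g₂ • y := by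
  have key := forall_smul_eq_of_forall_smul_eq (X := Y) (Y := X) hΨ hflipY (fun g => (hS g).symm)
    (n := g₂⁻¹ * g₁) (fun x => by rw [mul_smul, h12, inv_smul_smul]) y
  rw [mul_smul] at key
  simpa using congrArg (g₂ • ·) key

variable [Fintype X] [DecidableEq X] [Fintype Y] [DecidableEq Y]

/-- **Equal type stabilisers: an element preserving the pairs of `X` preserves the pairs of `Y`** (`|Y| = 6`, pair
flips on `Y`).  Such an `a` moving a point of `X` stabilises no `ρ`-type of `X`, hence (conjugating
`Stab(Φ) = Stab(Ψ)` and writing every type of `Y` as a pair-preserving translate of `Ψ`) no `ρ`-type of `Y`; the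
same for `aρ` unless it fixes `X`; and `a²` fixes `X`, hence `Y` — so the six-point lemma applies.
[cite: Gordon1999HodgeAVSurvey, §3 Theorem (proof)] [cite: Dodson1984, §5.1.2] -/
theorem pairPreserving_of_pairPreserving (hΦ : IsCMTypeWith ρ Φ) (hΨ : IsCMTypeWith ρ Ψ)
    (hflipY : ∀ y : Y, ∃ φ : G, φ • y = ρ • y ∧ ∀ z : Y, z ≠ y → z ≠ ρ • y → φ • z = z)
    (hS : ∀ g : G, (∀ x : X, g • x ∈ Φ ↔ x ∈ Φ) ↔ ∀ y : Y, g • y ∈ Ψ ↔ y ∈ Ψ)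
    (hcardY : Fintype.card Y = 6) {a : G} (ha : ∀ x : X, a • x = x ∨ a • x = ρ • x) (y : Y) :
    a • y = y ∨ a • y = ρ • y := by
  -- an element of `G` moving a point of `X` within its pair stabilises no `ρ`-type of `Y`
  have key : ∀ {b : G} {x₀ : X}, b • x₀ = ρ • x₀ → ∀ T : Set Y, IsCMTypeWith ρ T → ∃ y, ¬(b • y ∈ T ↔ y ∈ T) := by
    intro b x₀ hbx₀ T hT
    obtain ⟨c, -, hc⟩ := exists_pairPreserving_translate hΨ hflipY hT
    by_contra hall
    push Not at hall
    -- `c b c⁻¹` stabilises `Ψ`, hence `Φ`; so `b` stabilises the type `c⁻¹Φ` of `X`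
    have hstabΨ : ∀ y : Y, (c * b * c⁻¹) • y ∈ Ψ ↔ y ∈ Ψ := fun y => by
      rw [mul_smul, mul_smul, hc, hall, ← hc, smul_inv_smul]
    have hstabΦ := (hS _).2 hstabΨ
    obtain ⟨x, hx⟩ := not_forall_stabilizes_of_pairPreserving hbx₀ (hΦ.preimage_smul c)
    apply hx
    simp only [Set.mem_setOf_eq]
    have := hstabΦ (c • x)
    rwa [mul_smul, mul_smul, inv_smul_smul] at this
  by_cases hN : ∀ x : X, a • x = x
  · exact Or.inl (forall_smul_eq_of_forall_smul_eq (X := Y) (Y := X) hΨ hflipY (fun g => (hS g).symm) hN y)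
  push Not at hN
  obtain ⟨x₀, hx₀⟩ := hN
  have hax₀ : a • x₀ = ρ • x₀ := (ha x₀).resolve_left hx₀
  by_cases hNρ : ∀ x : X, (a * ρ) • x = x
  · right
    have h1 := forall_smul_eq_of_forall_smul_eq (X := Y) (Y := X) hΨ hflipY (fun g => (hS g).symm) hNρ (ρ • y)
    rwa [mul_smul, hΨ.invol] at h1
  push Not at hNρ
  obtain ⟨x₁, hx₁⟩ := hNρ
  have haρ : ∀ x : X, (a * ρ) • x = x ∨ (a * ρ) • x = ρ • x :=
    pairPreserving_mul hΦ ha (fun x => Or.inr rfl)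
  have hax₁ : (a * ρ) • x₁ = ρ • x₁ := (haρ x₁).resolve_left hx₁
  have ha2 : ∀ y : Y, a • a • y = y := fun y => by
    have := forall_smul_eq_of_forall_smul_eq (X := Y) (Y := X) hΨ hflipY (fun g => (hS g).symm)
      (n := a * a) (fun x => by rw [mul_smul]; exact smul_smul_eq_of_pairPreserving hΦ ha x) y
    rwa [mul_smul] at this
  exact pairPreserving_of_forall_not_stabilizes hΨ hcardY ha2 (key hax₀) (key hax₁) y

end TwoSlots

end Literature.NumberTheory.ComplexMultiplication
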